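import Summits.AnomalousDissipation.AnomalousDissipation.Theorems.SolenoidalFractalHomogenisationLagrangianStepD1TailCrushHopper
import Summits.AnomalousDissipation.AnomalousDissipation.Theorems.SolenoidalFractalHomogenisationLagrangianStepD1TailCrushZero
import Summits.AnomalousDissipation.AnomalousDissipation.Theorems.SolenoidalFractalHomogenisationLagrangianStepSidebandPathCensus
import HarnessLib

/-!
# K1L_D `stub_D1_V0thg` (stmt-AnomalousDissipation-27980), R3′ lane — R3′-2 `D1TailCrushBound` ASSEMBLED: the tail `psiStar − excQS − pairQS` of the cubature
# word is `RelSmall` of size `C·√ν/200000` relative to `excQS` on the sectorial block window (helper; `--supports stmt-AnomalousDissipation-27980 --as helper`)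

Helper file of route `SolenoidalFractalHomogenisation` (one-generation hand `leafhand-ad-solenoidalfractalh-1` g1, road E-c).  Classification of the 676 ordered
slot pairs `(j, j')` (pickup, source) of `IsotropicCubatureWord` by the FIRST HOPPER `i*(j')` (`first_hopper`) and `LadderCrush.pair_census`: diagonal
(`tail_bound_caseC_eps`), forward partners (`tail_bound_caseD_eps`), pickup cyclically strictly after `i*` (`tail_bound_hopper_class_eps`), pickup at or before
`i*` — then every intermediate slot is static and, by the census, `mⱼ ∦ m_{j'}` (`tail_bound_zero_class_eps`).  Hence:
* `tail_bound_pair_eps` — every pair: ν-free `C > 0`, `r₁ ∈ (0, 1/4]` with `|tailKernel ν S p q j j'| ≤ C·√ν·gTail j j'·(…)` for `ν = r³ ≤ r₁³`;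
* `tail_bound_all_eps` — ONE pair of constants for all 676 pairs (finite max / min);
* **`residueTail_crushed`** — for EVERY `ν ∈ (0, νB₁]` (the flat `tail_bound_all` covers `ν > r₁³` since `C ≥ 1/√(r₁³)`), every `S ∈ NearIso(10/11, 11/10) ∩
  OddSectorial(τ ≤ 1/20)`: `RelSmall (psiStar − excQS − pairQS) (excQS) (C·√ν/200000)` — the R3′-2 output of the R3′ plan memo (`σ_R = 1/2`; the memo's
  `σ_R = 1` would follow from the exponential form of `ladder_crush_slot_nu_exists`, not needed: «any σ_R closes the text of record», D28-16 (1)).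
What is NOT here: R3′-3 (frame-Lipschitz of `excQSθ`/`pairQSθ`, frame twins of the ladder chain) and the R3′-4 assembly into `stub_D1_V0thg`.  No definitions,
no sorry.  NOT a proof of `stub_D1_V0thg`, of K1L_D or of AD; rung F-D1.A0 infrastructure.
-/

set_option linter.dupNamespace false

noncomputable section

namespace Summit.AnomalousDissipation.AnomalousDissipation.Theorems.SolenoidalFractalHomogenisation.LagrangianStep.D1Tail

open Summit.AnomalousDissipation.AnomalousDissipation.Theorems
open Summit.AnomalousDissipation.AnomalousDissipation.Theorems.SolenoidalFractalHomogenisation.LagrangianStep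
open Summit.AnomalousDissipation.AnomalousDissipation.Theorems.SolenoidalFractalHomogenisation.LagrangianStep.WCrossing
open Summit.AnomalousDissipation.AnomalousDissipation.Theorems.SolenoidalFractalHomogenisation.LagrangianStep.D1TailCert
open Summit.AnomalousDissipation.AnomalousDissipation.Theorems.SolenoidalFractalHomogenisation.LagrangianStep.D1ResidueCert
open Summit.AnomalousDissipation.AnomalousDissipation.Theorems.SolenoidalFractalHomogenisation.LagrangianStep.Sideband
open Literature.Analysis Literature.Analysis.FluidPDE Literature.Analysis.FunctionSpaces Literature.Analysis.FunctionSpaces.Torus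
open Literature.Analysis.FluidPDE.Torus Literature.Analysis.FluidPDE.LatticeShear
open Set Real Complex
open scoped InnerProductSpace

/-- Lane A's table is nonnegative. [folklore] -/
theorem gTail_nonneg (j j' : Fin 26) : 0 ≤ gTail j j' := by
  rw [gTail_def]
  have h1 := G0_encl.1
  have h2 := tau_pos j
  have h3 := norm_m_pos j
  have h4 : 0 < Bst j' := by unfold Bst; have := norm_m_pos j'; positivity
  positivity

/-! ## §1 Every ordered slot pair -/

set_option maxHeartbeats 400000 in -- pre-budgeted (ops-buildfix rule): four-way classification
/-- **EVERY PAIR, CRUSHED**: for every `(j, j')` there are ν-free `C > 0`, `r₁ ∈ (0, 1/4]` with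
`|tailKernel ν S p q j j'| ≤ C·√ν·gTail j j'·(√PpSq_j(p)·√PpSq_{j'}(q))`, `ν = r³ ≤ r₁³`, on the sectorial block window.
[cite: ArmstrongVicol2025, §3] [cite: BedrossianCotiZelati2017, §2] [cite: MeshalkinSinai1961, pp. 1700–1705] -/
theorem tail_bound_pair_eps (j j' : Fin 26) :
    ∃ C r₁ : ℝ, 0 < C ∧ 0 < r₁ ∧ r₁ ≤ 1 / 4 ∧ ∀ {r : ℝ} (hr : 0 < r), r ≤ r₁ →
      ∀ {S : T4}, Torus.NearIso S (10 / 11) (11 / 10) → ∀ τ ∈ Icc (0:ℝ) (1 / 20), OddSectorial S τ → ∀ p q : Fin 3 → ℝ,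
      |tailKernel (r ^ 3) S p q j j'| ≤ C * Real.sqrt (r ^ 3) * (gTail j j' * (Real.sqrt (PpSq j p) * Real.sqrt (PpSq j' q))) := by
  by_cases hjj : j = j'
  · subst hjj; exact tail_bound_caseC_eps j
  by_cases hpart : (j' : ℕ) % 2 = 0 ∧ (j : ℕ) = (j' : ℕ) + 1
  · -- forward partner pair `(2l+1, 2l)`
    have hl : (j' : ℕ) / 2 < 13 := by have := j'.isLt; omega
    obtain ⟨C, r₁, hC, hr₁, hr₁4, h⟩ := tail_bound_caseD_eps ⟨(j' : ℕ) / 2, hl⟩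
    have e1 : sndSlot ⟨(j' : ℕ) / 2, hl⟩ = j := Fin.ext (by simp only [sndSlot, Fin.val_mk]; omega)
    have e2 : fstSlot ⟨(j' : ℕ) / 2, hl⟩ = j' := Fin.ext (by simp only [fstSlot, Fin.val_mk]; omega)
    rw [e1, e2] at h
    exact ⟨C, r₁, hC, hr₁, hr₁4, h⟩
  -- no fresh part
  have hfresh : ∀ S : T4, freshMat S j j' = 0 := fun S =>
    freshMat_eq_zero' S hjj fun l hl12 => by
      have h1 : (j : ℕ) = 2 * l.val + 1 := by rw [hl12.1]; rfl
      have h2 : (j' : ℕ) = 2 * l.val := by rw [hl12.2]; rfl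
      exact hpart ⟨by omega, by omega⟩
  obtain ⟨i, hij, hhop, hstat⟩ := first_hopper j'
  have hjj' : (j : ℕ) ≠ (j' : ℕ) := fun h => hjj (Fin.ext h)
  have hij' : (i : ℕ) ≠ (j' : ℕ) := fun h => hij (Fin.ext h)
  by_cases hafter : (j' < i ∧ i < j) ∨ (j < j' ∧ j' < i) ∨ (i < j ∧ j < j')
  · obtain ⟨C, r₁, hC, hr₁, hr₁4, h⟩ := tail_bound_hopper_class_eps hij hhop hstat hafter
    exact ⟨C, r₁, hC, hr₁, hr₁4, fun hr hr1 S hS τ hτ hodd p q => h hr hr1 hS τ hτ hodd (hfresh S) p q⟩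
  · -- the pickup lies at or before the first hopper: every intermediate slot is static
    have hstat' : ∀ l : Fin 26, l ≠ j' → ((j' < l ∧ l < j) ∨ (j < j' ∧ (j' < l ∨ l < j))) →
        (slots l).v 0 * (slots j').m 0 + (slots l).v 1 * (slots j').m 1 + (slots l).v 2 * (slots j').m 2 = 0 := by
      intro l hl h
      refine hstat l hl ?_
      simp only [Fin.lt_def] at h hafter ⊢
      omega
    -- non-colinearity from the pair census
    have hnc : (slots j).m 0 * (slots j').m 1 - (slots j).m 1 * (slots j').m 0 ≠ 0 ∨ (slots j).m 0 * (slots j').m 2 - (slots j).m 2 * (slots j').m 0 ≠ 0 ∨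
        (slots j).m 1 * (slots j').m 2 - (slots j).m 2 * (slots j').m 1 ≠ 0 := by
      rcases LadderCrush.pair_census j' j hjj with ⟨i₀, hi₀, hhop₀⟩ | h | h
      · exfalso
        refine hhop₀ (hstat' i₀ ?_ ?_)
        · intro e; rw [e] at hi₀; simp only [Fin.lt_def, Fin.le_def] at hi₀; omega
        · simp only [Fin.lt_def, Fin.le_def] at hi₀ ⊢; omega
      · rcases h with h | h | h
        · exact Or.inr (Or.inr h)
        · exact Or.inr (Or.inl fun e => h (by linarith))
        · exact Or.inl h
      · exact absurd h hpart
    obtain ⟨C, r₁, hC, hr₁, hr₁4, h⟩ := tail_bound_zero_class_eps hjj hnc hstat'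
    exact ⟨C, r₁, hC, hr₁, hr₁4, fun hr hr1 S hS τ hτ hodd p q => h hr hr1 hS τ hτ hodd (hfresh S) p q⟩

/-! ## §2 One pair of constants for all pairs -/

/-- **UNIFORM CONSTANTS**: one ν-free `C > 0`, `r₁ ∈ (0, 1/4]` for all 676 ordered pairs. [folklore] -/
theorem tail_bound_all_eps :
    ∃ C r₁ : ℝ, 0 < C ∧ 0 < r₁ ∧ r₁ ≤ 1 / 4 ∧ ∀ {r : ℝ} (hr : 0 < r), r ≤ r₁ →
      ∀ {S : T4}, Torus.NearIso S (10 / 11) (11 / 10) → ∀ τ ∈ Icc (0:ℝ) (1 / 20), OddSectorial S τ → ∀ (p q : Fin 3 → ℝ) (j j' : Fin 26),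
      |tailKernel (r ^ 3) S p q j j'| ≤ C * Real.sqrt (r ^ 3) * (gTail j j' * (Real.sqrt (PpSq j p) * Real.sqrt (PpSq j' q))) := by
  choose C r₁ hC hr₁ hr₁4 hb using tail_bound_pair_eps
  refine ⟨∑ j, ∑ j', C j j', Finset.univ.inf' Finset.univ_nonempty (fun x : Fin 26 × Fin 26 => r₁ x.1 x.2), ?_, ?_, ?_, ?_⟩
  · exact Finset.sum_pos (fun j _ => Finset.sum_pos (fun j' _ => hC j j') Finset.univ_nonempty) Finset.univ_nonempty
  · exact (Finset.lt_inf'_iff _).2 fun x _ => hr₁ x.1 x.2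
  · exact (Finset.inf'_le _ (Finset.mem_univ ((0 : Fin 26), (0 : Fin 26)))).trans (hr₁4 0 0)
  · intro r hr hr1 S hS τ hτ hodd p q j j'
    have hrj : r ≤ r₁ j j' := hr1.trans (Finset.inf'_le _ (Finset.mem_univ (j, j')))
    have h := hb j j' hr hrj hS τ hτ hodd p q
    have hCle : C j j' ≤ ∑ a, ∑ b, C a b :=
      (Finset.single_le_sum (f := fun b => C j b) (fun b _ => (hC j b).le) (Finset.mem_univ j')).trans
        (Finset.single_le_sum (f := fun a => ∑ b, C a b) (fun a _ => Finset.sum_nonneg fun b _ => (hC a b).le) (Finset.mem_univ j))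
    have hg : 0 ≤ gTail j j' * (Real.sqrt (PpSq j p) * Real.sqrt (PpSq j' q)) :=
      mul_nonneg (gTail_nonneg j j') (mul_nonneg (Real.sqrt_nonneg _) (Real.sqrt_nonneg _))
    exact h.trans (mul_le_mul_of_nonneg_right (mul_le_mul_of_nonneg_right hCle (Real.sqrt_nonneg _)) hg)

/-! ## §3 The crushed tail certificate -/

/-- `(ν^{1/3})³ = ν`. [folklore] -/
theorem rpow_third_pow_three {ν : ℝ} (hν : 0 ≤ ν) : (ν ^ (1 / 3 : ℝ)) ^ 3 = ν := by
  rw [← Real.rpow_natCast, ← Real.rpow_mul hν]; norm_num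

/-- **R3′-2 `D1TailCrushBound`: THE CRUSHED TAIL CERTIFICATE.**  There is a ν-free `C > 0` such that for every `ν ∈ (0, νB₁]` and every
`S ∈ NearIso(10/11, 11/10) ∩ OddSectorial(τ ≤ 1/20)`:
`RelSmall (psiStar cubatureWord MB ν S − excQS cubatureWord MB S − pairQS S) (excQS cubatureWord MB S) (C·√ν/200000)`.
[cite: ArmstrongVicol2025, §3 (renormalised diffusivity of one level)] [cite: BedrossianCotiZelati2017, §2 (hypocoercivity, enhanced dissipation)]
[cite: MajdaKramer1999, §2.2.1.3 (55)] -/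
theorem residueTail_crushed : ∃ C : ℝ, 0 < C ∧
    ∀ ν ∈ Set.Ioc 0 νB₁, ∀ S : Torus.Visc4 (Fin 3), Torus.NearIso S (10 / 11) (11 / 10) →
      ∀ τ ∈ Set.Icc (0:ℝ) (1 / 20), OddSectorial S τ →
        RelSmall (Sideband.psiStar cubatureWord MB MB_pos ν S - excQS cubatureWord MB S - pairQS S)
          (excQS cubatureWord MB S) (C * Real.sqrt ν / 200000) := by
  obtain ⟨C, r₁, hC, hr₁, hr₁4, hb⟩ := tail_bound_all_eps
  have hν₁ : 0 < r₁ ^ 3 := pow_pos hr₁ 3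
  set C' : ℝ := max C (1 / Real.sqrt (r₁ ^ 3)) with hC'
  have hC'pos : 0 < C' := lt_max_of_lt_left hC
  refine ⟨C', hC'pos, ?_⟩
  have key := residueTail_of_crushedSlotPairBounds_gTail (fun ν => C' * Real.sqrt ν) ?_
  · exact key
  intro ν hν S hS τ hτ hodd p q j j'
  have hν0 : 0 < ν := hν.1
  have hν40 : ν ≤ 1 / 40 := hν.2.trans (le_of_eq rfl)
  by_cases hsmall : ν ≤ r₁ ^ 3
  · -- the crushed regime: `ν = r³`, `r = ν^{1/3} ≤ r₁`
    set r : ℝ := ν ^ (1 / 3 : ℝ) with hr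
    have hr0 : 0 < r := Real.rpow_pos_of_pos hν0 _
    have hr3 : r ^ 3 = ν := rpow_third_pow_three hν0.le
    have hrr₁ : r ≤ r₁ := by
      have h : r ^ 3 ≤ r₁ ^ 3 := by rw [hr3]; exact hsmall
      exact le_of_pow_le_pow_left₀ (by norm_num) hr₁.le h
    have h := hb hr0 hrr₁ hS τ hτ hodd p q j j'
    rw [hr3] at h
    refine h.trans ?_
    have hg : 0 ≤ gTail j j' * (Real.sqrt (PpSq j p) * Real.sqrt (PpSq j' q)) :=
      mul_nonneg (gTail_nonneg j j') (mul_nonneg (Real.sqrt_nonneg _) (Real.sqrt_nonneg _))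
    have : C * Real.sqrt ν ≤ C' * Real.sqrt ν := mul_le_mul_of_nonneg_right (le_max_left _ _) (Real.sqrt_nonneg _)
    nlinarith
  · -- the flat regime `ν > r₁³`: lane A's bound, and `C'√ν ≥ √ν/√(r₁³) ≥ 1`
    have hν' : ν ∈ Ioc (0:ℝ) (1 / 40) := ⟨hν0, hν40⟩
    have hflat := tail_bound_all hν' hS p q j j'
    have hge : 1 ≤ C' * Real.sqrt ν := by
      have h1 : Real.sqrt (r₁ ^ 3) ≤ Real.sqrt ν := Real.sqrt_le_sqrt (le_of_lt (not_le.1 hsmall))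
      have h2 : 0 < Real.sqrt (r₁ ^ 3) := Real.sqrt_pos.2 hν₁
      calc (1:ℝ) = 1 / Real.sqrt (r₁ ^ 3) * Real.sqrt (r₁ ^ 3) := by field_simp
        _ ≤ C' * Real.sqrt ν := mul_le_mul (le_max_right _ _) h1 h2.le hC'pos.le
    have hg : 0 ≤ gTail j j' * (Real.sqrt (PpSq j p) * Real.sqrt (PpSq j' q)) :=
      mul_nonneg (gTail_nonneg j j') (mul_nonneg (Real.sqrt_nonneg _) (Real.sqrt_nonneg _))
    calc |tailKernel ν S p q j j'| ≤ gTail j j' * (Real.sqrt (PpSq j p) * Real.sqrt (PpSq j' q)) := hflat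
      _ = 1 * (gTail j j' * (Real.sqrt (PpSq j p) * Real.sqrt (PpSq j' q))) := (one_mul _).symm
      _ ≤ C' * Real.sqrt ν * (gTail j j' * (Real.sqrt (PpSq j p) * Real.sqrt (PpSq j' q))) := mul_le_mul_of_nonneg_right hge hg
      _ = C' * Real.sqrt ν * gTail j j' * (Real.sqrt (PpSq j p) * Real.sqrt (PpSq j' q)) := by ring

end Summit.AnomalousDissipation.AnomalousDissipation.Theorems.SolenoidalFractalHomogenisation.LagrangianStep.D1Tail

end
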